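import Summits.Ventures.Crystal3D.Theorems.StickyWulffConstantCoaxialWallLawReadingDirections
import HarnessLib

/-!
# Reading directions III: the cross product in fine coordinates, APEX VECTORS and MODULE BONDS are reading directions
# (crux `CoaxialWallLaw`, stmt-Ventures-19481, line `WallLedgerF`; T4 brick, census-free)

HONEST FRAMING. Venture `Summits/Ventures/Crystal3D` (cell `crystal3d-full`); helper `--supports` the crux `CoaxialWallLaw`
(stmt-Ventures-19481, `route-Ventures-StickyWulffConstant`), REGISTERED line `WallLedgerF` (planner cf-p1, (xcv)(1): T4 pieces first).
Census-free; F-C1 not moved.  Continues `…ReadingDirections` (p696139):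
* `crossI`, `cross_fineVec` — `cross (fineVec t) (fineVec u) = −(√2/18) • fineVec (t × u)` (the cubic frame is left-handed);
* `apexVec_fineVec`, `apexFine`, `apexFine_table` (`decide`), `apexVec_modSite` — the apex over an adjacent menu pair in fine
  coordinates; **`apexVecs_sub_readingDirs`** — every first-generation apex vector is a reading direction;
* `modSite_sub`, `norm_modSite_sq` (`‖modSite d‖² = dsq12 0 d / 12`), `mem_menuOffsets_of_dsq12`, **`modSite_bond_mem_readingDirs`** —
  the bond between two module balls at distance `1` is a reading direction.
So every direction in which a MODULE ball reads a module ball or a first-generation apex ball is in `readingDirs`, and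
`stdFrame_of_reading_triangle` applies to such readers.
WHAT THIS IS NOT: not the apex-ball reader tables (apex–module, apex–apex), not type soundness; F-C1 not moved.
-/

noncomputable section

namespace Summit.Ventures.Crystal3D.Theorems

namespace TailResidue

open Summit.Ventures.Crystal3D Finset NearIdentity
open scoped InnerProductSpace

/-! ### The cross product in fine coordinates -/

/-- Integer cross product. -/
def crossI (t u : ℤ × ℤ × ℤ) : ℤ × ℤ × ℤ :=
  (t.2.1 * u.2.2 - t.2.2 * u.2.1, t.2.2 * u.1 - t.1 * u.2.2, t.1 * u.2.1 - t.2.1 * u.1)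

/-- **The cross product of fine vectors** (the cubic frame `cubicFrame` is LEFT-handed, whence the sign). -/
theorem cross_fineVec (t u : ℤ × ℤ × ℤ) :
    cross (fineVec t) (fineVec u) = (-(Real.sqrt 2 / 18)) • fineVec (crossI t u) := by
  have h2 : Real.sqrt 2 ^ 2 = 2 := Real.sq_sqrt (by norm_num)
  have h24 : Real.sqrt 2 ^ 4 = 4 := by nlinarith [h2]
  have h3 : Real.sqrt 3 ^ 2 = 3 := Real.sq_sqrt (by norm_num)
  have h3' : Real.sqrt 3 ≠ 0 := by positivity
  have h2' : Real.sqrt 2 ≠ 0 := by positivity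
  ext i
  fin_cases i <;> simp [cross, fineVec, cubicFrame, crossI] <;> field_simp <;> ring_nf <;> simp only [h2, h3, h24] <;> ring_nf

/-! ### Apex vectors -/

/-- **The apex over fine vectors**: `apexVec (fineVec A) (fineVec B) up = fineVec (P ∓ Q)` when `A + B = 3P` and `2(A × B) = 27Q`
(`−` for `up`). -/
theorem apexVec_fineVec {A B : ℤ × ℤ × ℤ} {p0 p1 p2 q0 q1 q2 : ℤ}
    (hP : (A.1 + B.1, A.2.1 + B.2.1, A.2.2 + B.2.2) = (3 * p0, 3 * p1, 3 * p2))
    (hQ : (2 * (crossI A B).1, 2 * (crossI A B).2.1, 2 * (crossI A B).2.2) = (27 * q0, 27 * q1, 27 * q2)) (up : Bool) :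
    apexVec (fineVec A) (fineVec B) up =
      fineVec (p0 + (if up then -1 else 1) * q0, p1 + (if up then -1 else 1) * q1, p2 + (if up then -1 else 1) * q2) := by
  simp only [Prod.mk.injEq] at hP hQ
  obtain ⟨hp0, hp1, hp2⟩ := hP
  obtain ⟨hq0, hq1, hq2⟩ := hQ
  have e0 : ((A.1 + B.1 : ℤ) : ℝ) = 3 * p0 := by exact_mod_cast hp0
  have e1 : ((A.2.1 + B.2.1 : ℤ) : ℝ) = 3 * p1 := by exact_mod_cast hp1
  have e2 : ((A.2.2 + B.2.2 : ℤ) : ℝ) = 3 * p2 := by exact_mod_cast hp2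
  have f0 : ((2 * (crossI A B).1 : ℤ) : ℝ) = 27 * q0 := by exact_mod_cast hq0
  have f1 : ((2 * (crossI A B).2.1 : ℤ) : ℝ) = 27 * q1 := by exact_mod_cast hq1
  have f2 : ((2 * (crossI A B).2.2 : ℤ) : ℝ) = 27 * q2 := by exact_mod_cast hq2
  push_cast at e0 e1 e2 f0 f1 f2
  have h2 : Real.sqrt 2 ^ 2 = 2 := Real.sq_sqrt (by norm_num)
  have hp := nine_sqrt_two_pos
  have hs : Real.sqrt 2 ≠ 0 := by positivity
  have hlin := fineVec_lin (p0, p1, p2) (q0, q1, q2) (if up then -1 else 1)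
  dsimp only at hlin
  rw [hlin, apexVec, cross_fineVec, smul_smul]
  apply cubicCoords_injective
  simp only [cubicCoords_add, cubicCoords_smul, cubicCoords_fineVec]
  ext i
  cases up <;> fin_cases i <;> simp <;> field_simp
  · linear_combination 18 * e0 + 2 * f0 + 2 * ((crossI A B).1 : ℝ) * h2
  · linear_combination 18 * e1 + 2 * f1 + 2 * ((crossI A B).2.1 : ℝ) * h2
  · linear_combination 18 * e2 + 2 * f2 + 2 * ((crossI A B).2.2 : ℝ) * h2
  · linear_combination 18 * e0 - 2 * f0 - 2 * ((crossI A B).1 : ℝ) * h2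
  · linear_combination 18 * e1 - 2 * f1 - 2 * ((crossI A B).2.1 : ℝ) * h2
  · linear_combination 18 * e2 - 2 * f2 - 2 * ((crossI A B).2.2 : ℝ) * h2

/-- The apex over the adjacent menu pair `(a, b)` in fine coordinates (integer formula; exact on adjacent menu pairs). -/
def apexFine (a b : ℤ × ℤ × ℤ) (up : Bool) : ℤ × ℤ × ℤ :=
  (((siteFine a).1 + (siteFine b).1) / 3 + (if up then -1 else 1) * (2 * (crossI (siteFine a) (siteFine b)).1 / 27),
    ((siteFine a).2.1 + (siteFine b).2.1) / 3 + (if up then -1 else 1) * (2 * (crossI (siteFine a) (siteFine b)).2.1 / 27),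
    ((siteFine a).2.2 + (siteFine b).2.2) / 3 + (if up then -1 else 1) * (2 * (crossI (siteFine a) (siteFine b)).2.2 / 27))

/-- The adjacent ordered menu pairs (`84` of them). -/
def menuPairs : Finset ((ℤ × ℤ × ℤ) × (ℤ × ℤ × ℤ)) := (menuOffsets ×ˢ menuOffsets).filter fun ab => dsq12 ab.1 ab.2 = 12

set_option maxRecDepth 65536 in
/-- Bookkeeping (kernel `decide`) over the `84` adjacent menu pairs: the divisibilities making `apexFine` exact, and
`apexFine a b up ∈ VInt`. -/
theorem apexFine_table : ∀ ab ∈ menuPairs,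
    ((siteFine ab.1).1 + (siteFine ab.2).1, (siteFine ab.1).2.1 + (siteFine ab.2).2.1, (siteFine ab.1).2.2 + (siteFine ab.2).2.2) =
      (3 * (((siteFine ab.1).1 + (siteFine ab.2).1) / 3), 3 * (((siteFine ab.1).2.1 + (siteFine ab.2).2.1) / 3),
        3 * (((siteFine ab.1).2.2 + (siteFine ab.2).2.2) / 3)) ∧
    (2 * (crossI (siteFine ab.1) (siteFine ab.2)).1, 2 * (crossI (siteFine ab.1) (siteFine ab.2)).2.1,
        2 * (crossI (siteFine ab.1) (siteFine ab.2)).2.2) =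
      (27 * (2 * (crossI (siteFine ab.1) (siteFine ab.2)).1 / 27), 27 * (2 * (crossI (siteFine ab.1) (siteFine ab.2)).2.1 / 27),
        27 * (2 * (crossI (siteFine ab.1) (siteFine ab.2)).2.2 / 27)) ∧
    apexFine ab.1 ab.2 true ∈ VInt ∧ apexFine ab.1 ab.2 false ∈ VInt := by
  decide

/-- **The apex over an adjacent menu pair in fine coordinates.** -/
theorem apexVec_modSite {a b : ℤ × ℤ × ℤ} (hab : (a, b) ∈ menuPairs) (up : Bool) :
    apexVec (modSite a) (modSite b) up = fineVec (apexFine a b up) := by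
  obtain ⟨hP, hQ, -, -⟩ := apexFine_table (a, b) hab
  dsimp only at hP hQ
  rw [modSite_eq_fineVec, modSite_eq_fineVec, apexVec_fineVec hP hQ up]
  rfl

set_option maxRecDepth 65536 in
/-- **Every first-generation apex vector is a reading direction.** -/
theorem apexVecs_sub_readingDirs {v : EuclideanSpace ℝ (Fin 3)} (hv : v ∈ apexVecs) : v ∈ readingDirs := by
  unfold apexVecs at hv
  rw [Finset.mem_image] at hv
  obtain ⟨⟨⟨a, b⟩, up⟩, hp, rfl⟩ := hv
  rw [Finset.mem_product] at hp
  obtain ⟨hab, -⟩ := hp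
  obtain ⟨-, -, ht, hf⟩ := apexFine_table (a, b) hab
  dsimp only at ht hf ⊢
  rw [apexVec_modSite hab]
  cases up
  · exact ⟨_, hf, rfl⟩
  · exact ⟨_, ht, rfl⟩

/-! ### Module bonds -/

/-- `modSite` is additive: differences of sites. -/
theorem modSite_sub (s t : ℤ × ℤ × ℤ) : modSite t - modSite s = modSite (t.1 - s.1, t.2.1 - s.2.1, t.2.2 - s.2.2) := by
  simp only [modSite]
  push_cast
  module

/-- **The squared length of a module vector**: `‖modSite d‖² = dsq12 0 d / 12`. -/
theorem norm_modSite_sq (d : ℤ × ℤ × ℤ) : ‖modSite d‖ ^ 2 = (dsq12 (0, 0, 0) d : ℝ) / 12 := by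
  rw [← real_inner_self_eq_norm_sq, modSite_eq_fineVec, inner_fineVec, dotI, siteFine, dsq12]
  push_cast
  ring

/-- The squared distance of two module sites: `dsq12 s t / 12`. -/
theorem dist_modSite_sq (s t : ℤ × ℤ × ℤ) : dist (modSite s) (modSite t) ^ 2 = (dsq12 s t : ℝ) / 12 := by
  rw [dist_comm, dist_eq_norm, modSite_sub, norm_modSite_sq, dsq12, dsq12]
  push_cast
  ring

/-- A site at `dsq12 = 12` from `0` is a menu offset. -/
theorem mem_menuOffsets_of_dsq12 {d : ℤ × ℤ × ℤ} (h : dsq12 (0, 0, 0) d = 12) : d ∈ menuOffsets := by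
  obtain ⟨i, n, k⟩ := d
  simp only [dsq12, sub_zero] at h
  rw [menuOffsets, Finset.mem_filter, Finset.mem_product, Finset.mem_product, Finset.mem_Icc, Finset.mem_Icc, Finset.mem_Icc]
  refine ⟨⟨⟨?_, ?_⟩, ⟨?_, ?_⟩, ⟨?_, ?_⟩⟩, by simp only [dsq12, sub_zero]; exact h⟩ <;>
    nlinarith [sq_nonneg (2 * i + n), sq_nonneg n, sq_nonneg k, sq_nonneg (i + n), sq_nonneg i]

/-- **A module bond is a reading direction**: two module balls at distance `1` differ by `modSite` of a menu offset, which lies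
in `readingDirs`. -/
theorem modSite_bond_mem_readingDirs {s t : ℤ × ℤ × ℤ} (h : dist (modSite s) (modSite t) = 1) :
    modSite t - modSite s ∈ readingDirs := by
  have hsq := dist_modSite_sq s t
  rw [h, one_pow] at hsq
  have h12 : dsq12 s t = 12 := by
    have : (dsq12 s t : ℝ) = 12 := by linarith
    exact_mod_cast this
  have h0 : dsq12 (0, 0, 0) (t.1 - s.1, t.2.1 - s.2.1, t.2.2 - s.2.2) = 12 := by
    rw [← h12, dsq12, dsq12]; ring
  rw [modSite_sub]
  exact modSite_menu_mem_readingDirs (mem_menuOffsets_of_dsq12 h0)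

end TailResidue

end Summit.Ventures.Crystal3D.Theorems

end
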